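import Summits.CriticalPhenomena.PercolationContinuityZ3.Theses.PercNearOneGluing
import Literature.Probability.Percolation.PercolationProofs
import Literature.Probability.Percolation.ConditionalPositiveAssociationProofs
import Literature.Probability.Percolation.TwoClusterConditionalAssociationProofs
import Literature.Probability.LatticeModels.ProdBernoulliClusterLocality

/-! TTRL-lite variant V150 of stmt-CriticalPhenomena-4576 -/

namespace Summit.CriticalPhenomena.PercolationContinuityZ3.Theorems

open MeasureTheory Literature.Probability.LatticeModels Literature.Probability.Percolation
open scoped Classical BigOperators

/-- TTRL-lite variant V150 (`drop_hyp:5`) of the good-step inequality behind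
`stmt-CriticalPhenomena-4576` (AdditiveGluing) is FALSE.  Once the hypothesis
`∀ a ∈ A, 1 - t ≤ P(a ↔ b)` is dropped, `t` is an arbitrary real while the left-hand side is a
sum of non-negative reals, so `t = -1` refutes it as soon as the remaining hypotheses are
satisfiable.  Witness: `n = 3`, `o = 0`, `b = 1`, `A = {1}`, `y = 2`, `w = 𝟙_{s(0,2)}`.  The
induction hypothesis holds for this `w`: any `w'` with fewer active vertices vanishes off the
diagonal, so `prodBernoulli w'`-a.s. no edge is open, reachability is equality, the first term
and all cluster terms with `W ≠ {o'}` vanish, and the remaining term is `0` when `A' = {b'}`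
(reflexivity of `openConnIn`) and at most `1 ≤ t` otherwise (from `1 - t ≤ P(c ↔ b') = 0`). -/
theorem cp4576_goodstep_var150_false : ¬ (∀ (n : ℕ) (w : Sym2 (Fin n) → unitInterval) (A : Finset (Fin n)) (o b : Fin n), b ∈ A → o ∉ A → (∃ y : Fin n, y ∉ A ∧ y ≠ o ∧ (w s(o, y) : ℝ) ≠ 0) → (∀ w' : Sym2 (Fin n) → unitInterval, (Finset.univ.filter (fun v : Fin n => ∃ u : Fin n, 0 < (w' s(u, v) : ℝ))).card < (Finset.univ.filter (fun v : Fin n => ∃ u : Fin n, 0 < (w s(u, v) : ℝ))).card → ∀ (A' : Finset (Fin n)) (o' b' : Fin n), b' ∈ A' → o' ∉ A' → ∀ (t : ℝ) (sel : Finset (Fin n) → Fin n), (∀ W, sel W ∈ A') → (∀ a ∈ A', 1 - t ≤ (prodBernoulli w').real (openConn a b')) → (prodBernoulli w').real ((⋃ a ∈ A', openConn o' a) ∩ (openConn o' b')ᶜ) + ∑ W ∈ (Finset.univ : Finset (Finset (Fin n))).filter (fun W => o' ∈ W ∧ Disjoint W A'), (prodBernoulli w').real {ω : BondConfig (Fin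 n) | openCluster ω o' = (W : Set (Fin n))} * (prodBernoulli w').real (openConnIn ((W : Set (Fin n))ᶜ) (sel W) b')ᶜ ≤ t) → ∀ (t : ℝ) (sel : Finset (Fin n) → Fin n), (∀ W, sel W ∈ A) → (prodBernoulli w).real ((⋃ a ∈ A, openConn o a) ∩ (openConn o b)ᶜ) + ∑ W ∈ (Finset.univ : Finset (Finset (Fin n))).filter (fun W => o ∈ W ∧ Disjoint W A), (prodBernoulli w).real {ω : BondConfig (Fin n) | openCluster ω o = (W : Set (Fin n))} * (prodBernoulli w).real (openConnIn ((W : Set (Fin n))ᶜ) (sel W) b)ᶜ ≤ t) := by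
  intro h
  -- the induction hypothesis for the witness weight `𝟙_{s(0,2)}` on `Fin 3`
  have hIH : ∀ w' : Sym2 (Fin 3) → unitInterval,
      (Finset.univ.filter (fun v : Fin 3 => ∃ u : Fin 3, 0 < (w' s(u, v) : ℝ))).card <
        (Finset.univ.filter (fun v : Fin 3 => ∃ u : Fin 3,
          0 < ((if s(u, v) = s((0 : Fin 3), (2 : Fin 3)) then (1 : unitInterval) else 0 :
            unitInterval) : ℝ))).card →
      ∀ (A' : Finset (Fin 3)) (o' b' : Fin 3), b' ∈ A' → o' ∉ A' →
      ∀ (t : ℝ) (sel : Finset (Fin 3) → Fin 3), (∀ W, sel W ∈ A') →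
      (∀ a ∈ A', 1 - t ≤ (prodBernoulli w').real (openConn a b')) →
      (prodBernoulli w').real ((⋃ a ∈ A', openConn o' a) ∩ (openConn o' b')ᶜ) +
        ∑ W ∈ (Finset.univ : Finset (Finset (Fin 3))).filter (fun W => o' ∈ W ∧ Disjoint W A'),
          (prodBernoulli w').real {ω : BondConfig (Fin 3) | openCluster ω o' = (W : Set (Fin 3))} *
            (prodBernoulli w').real (openConnIn ((W : Set (Fin 3))ᶜ) (sel W) b')ᶜ ≤ t := by
    intro w' hcard A' o' b' hb' ho' t sel hsel ht
    -- Step A: the witness weight has at most two active vertices, so `w'` has at most one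
    have hle2 : (Finset.univ.filter (fun v : Fin 3 => ∃ u : Fin 3,
          0 < ((if s(u, v) = s((0 : Fin 3), (2 : Fin 3)) then (1 : unitInterval) else 0 :
            unitInterval) : ℝ))).card ≤ 2 := by
      calc _ ≤ ({0, 2} : Finset (Fin 3)).card := by
            apply Finset.card_le_card
            intro v hv
            simp only [Finset.mem_filter, Finset.mem_univ, true_and] at hv
            obtain ⟨u, hu⟩ := hv
            by_contra hv'
            have hne : s(u, v) ≠ s((0 : Fin 3), (2 : Fin 3)) := by
              intro he
              apply hv'
              rw [Sym2.eq_iff] at he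
              rcases he with ⟨-, rfl⟩ | ⟨-, rfl⟩ <;> simp
            rw [if_neg hne] at hu
            simp at hu
        _ ≤ 2 := Finset.card_le_two
    have hcard1 : (Finset.univ.filter (fun v : Fin 3 => ∃ u : Fin 3, 0 < (w' s(u, v) : ℝ))).card
        ≤ 1 := Nat.lt_succ_iff.1 (lt_of_lt_of_le hcard hle2)
    -- hence `w'` vanishes off the diagonal
    have hoff : ∀ u v : Fin 3, u ≠ v → w' s(u, v) = 0 := by
      intro u v huv
      by_contra hne
      have hpos : 0 < (w' s(u, v) : ℝ) :=
        unitInterval.coe_pos.2 (unitInterval.pos_iff_ne_zero.2 hne)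
      have hu : u ∈ Finset.univ.filter (fun v : Fin 3 => ∃ u : Fin 3, 0 < (w' s(u, v) : ℝ)) := by
        simp only [Finset.mem_filter, Finset.mem_univ, true_and]
        exact ⟨v, by rwa [Sym2.eq_swap]⟩
      have hv : v ∈ Finset.univ.filter (fun v : Fin 3 => ∃ u : Fin 3, 0 < (w' s(u, v) : ℝ)) := by
        simp only [Finset.mem_filter, Finset.mem_univ, true_and]
        exact ⟨u, hpos⟩
      have h2 : ({u, v} : Finset (Fin 3)).card ≤ 1 :=
        (Finset.card_le_card
          (Finset.insert_subset_iff.2 ⟨hu, Finset.singleton_subset_iff.2 hv⟩)).trans hcard1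
      rw [Finset.card_pair huv] at h2
      omega
    -- Step B: almost surely no edge is open, so open reachability is equality
    have hae : ∀ᵐ ω ∂prodBernoulli w', ∀ x y : Fin 3, (openGraph ω).Reachable x y → x = y := by
      have h0 := prodBernoulli_ae_forall_notMem w' (Z := {e : Sym2 (Fin 3) | ¬ e.IsDiag})
        (Set.to_countable _)
        (by
          intro e he
          induction e using Sym2.ind with
          | _ u v => exact hoff u v (fun huv => he (Sym2.mk_isDiag_iff.2 huv)))
      filter_upwards [h0] with ω hω x y hxy
      obtain ⟨p⟩ := hxy
      cases p with
      | nil => rfl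
      | cons hadj _ =>
        rw [openGraph_adj] at hadj
        exact absurd hadj.1 (hω _ (fun hd => hadj.2 (Sym2.mk_isDiag_iff.1 hd)))
    have hreal0 : ∀ s : Set (BondConfig (Fin 3)),
        (∀ ω, (∀ x y : Fin 3, (openGraph ω).Reachable x y → x = y) → ω ∉ s) →
        (prodBernoulli w').real s = 0 := by
      intro s hs
      rw [measureReal_def, measure_eq_zero_iff_ae_notMem.2 (hae.mono fun ω hω => hs ω hω),
        ENNReal.toReal_zero]
    -- Step C: the first term vanishes (`o' ↔ a` forces `o' = a ∈ A'`)
    have h1 : (prodBernoulli w').real ((⋃ a ∈ A', openConn o' a) ∩ (openConn o' b')ᶜ) = 0 := by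
      refine hreal0 _ fun ω hω hmem => ?_
      obtain ⟨a, ha, hωa⟩ := Set.mem_iUnion₂.1 hmem.1
      exact ho' (hω o' a hωa ▸ ha)
    -- Step D: `t ≥ 0` from `a := b'`
    have ht0 : 0 ≤ t := by
      have h' := ht b' hb'
      have h'' : (prodBernoulli w').real (openConn b' b') ≤ 1 := measureReal_le_one
      linarith
    -- Step E: the sum collapses to `W = {o'}`
    have hmemf : ({o'} : Finset (Fin 3)) ∈
        (Finset.univ : Finset (Finset (Fin 3))).filter (fun W => o' ∈ W ∧ Disjoint W A') := by
      simp [ho']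
    have hsum : ∑ W ∈ (Finset.univ : Finset (Finset (Fin 3))).filter
          (fun W => o' ∈ W ∧ Disjoint W A'),
          (prodBernoulli w').real {ω : BondConfig (Fin 3) | openCluster ω o' = (W : Set (Fin 3))} *
            (prodBernoulli w').real (openConnIn ((W : Set (Fin 3))ᶜ) (sel W) b')ᶜ =
        (prodBernoulli w').real
            {ω : BondConfig (Fin 3) | openCluster ω o' = (({o'} : Finset (Fin 3)) : Set (Fin 3))} *
          (prodBernoulli w').real
            (openConnIn ((({o'} : Finset (Fin 3)) : Set (Fin 3))ᶜ) (sel {o'}) b')ᶜ := by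
      refine Finset.sum_eq_single _ (fun W _ hW => ?_) (fun hn => absurd hmemf hn)
      rw [hreal0 _ fun ω hω hmem => hW ?_, zero_mul]
      have hC : openCluster ω o' = {o'} := by
        ext y
        simp only [openCluster, Set.mem_setOf_eq, Set.mem_singleton_iff]
        exact ⟨fun hy => (hω o' y hy).symm, fun hy => hy ▸ SimpleGraph.Reachable.refl _⟩
      rw [Set.mem_setOf_eq, hC] at hmem
      exact Finset.coe_eq_singleton.1 hmem.symm
    rw [h1, zero_add, hsum]
    -- Step F: either some `c ∈ A'` differs from `b'` (then `t ≥ 1`) or `A' = {b'}` (term is `0`)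
    by_cases hA : ∃ c ∈ A', c ≠ b'
    · obtain ⟨c, hc, hcb⟩ := hA
      have hc0 : (prodBernoulli w').real (openConn c b') = 0 :=
        hreal0 _ fun ω hω hmem => hcb (hω c b' hmem)
      have ht1 : 1 ≤ t := by have h' := ht c hc; rw [hc0] at h'; linarith
      calc _ ≤ (1 : ℝ) * 1 :=
            mul_le_mul measureReal_le_one measureReal_le_one measureReal_nonneg zero_le_one
        _ ≤ t := by linarith
    · push Not at hA
      have hsb : sel {o'} = b' := hA _ (hsel {o'})
      have hbo : b' ≠ o' := fun hb => ho' (hb ▸ hb')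
      have hempty : (openConnIn ((({o'} : Finset (Fin 3)) : Set (Fin 3))ᶜ) (sel {o'}) b')ᶜ = ∅ := by
        rw [Set.compl_empty_iff, hsb]
        refine Set.eq_univ_of_forall fun ω => ?_
        have hb'S : b' ∈ ((({o'} : Finset (Fin 3)) : Set (Fin 3))ᶜ) := by simp [hbo]
        exact ⟨hb'S, hb'S, SimpleGraph.Reachable.refl _⟩
      rw [hempty, measureReal_empty, mul_zero]
      exact ht0
  have key := h 3 (fun e => if e = s((0 : Fin 3), (2 : Fin 3)) then 1 else 0) {1} 0 1 (by decide)
    (by decide) ⟨2, by decide, by decide, by simp⟩ hIH (-1) (fun _ => 1)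
    (fun _ => Finset.mem_singleton_self _)
  have hfin : ∀ x : ℝ, x ≤ -1 → 0 ≤ x → False := fun x h1 h2 => by linarith
  exact hfin _ key (add_nonneg measureReal_nonneg
    (Finset.sum_nonneg fun _ _ => mul_nonneg measureReal_nonneg measureReal_nonneg))

end Summit.CriticalPhenomena.PercolationContinuityZ3.Theorems
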